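import Literature.NumberTheory.LFunctions.ThetaChainFreeCheck
import HarnessLib

/-!
# Schoenfeld's `θ`-bound on `[599, 10⁸]` by kernel computation: data-free run, chunk 29 of 35

Topic: `Literature/NumberTheory/LFunctions`. Pure proof file (a kernel computation; nothing is
asserted, no definition). The theorems below evaluate `ThetaChain.runFree` — together `150000`
data-free steps of the certified `θ`-chain (`ThetaChain.stepFree`, `ThetaChainFreeCheck.lean`: the
next prime found and certified by two gcds with the primorials of the odd primes `≤ 2999` and in
`(2999, 10007]`, the enclosures of `log p` and `θ(p)`, and the two comparisons behind
`|θ(x) − x| ≤ √x log² x/(8π)`) — from the state at the prime `82291571` to the state at the prime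
`85030553`. Soundness: `ThetaChain.runFree_sound`; assembly of the 35 chunks: `ThetaUpTo1e8.lean`.
The expected states were obtained by evaluating a twin of the same function outside the kernel
(validated bit-for-bit on the tree's chunk `ThetaChainRun.xrun14`). Declarations of `5·10⁴` steps
(about `70 s` of kernel time each; the kernel's evaluation is linear within a declaration of this size),
`decide +kernel`, standard axioms only (`maxHeartbeats 0` lifts the deterministic time-out).

## References

* L. Schoenfeld, *Sharper bounds for the Chebyshev functions θ(x) and ψ(x). II*, Math. Comp. 30
  (1976), 337–360, Thm. 10 (6.3). [Schoenfeld1976]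
* J. B. Rosser, L. Schoenfeld, *Approximate formulas for some functions of prime numbers*,
  Illinois J. Math. 6 (1962), 64–94, Thms. 18–19 (`θ`-tables to `10⁸`). [RosserSchoenfeld1962]
-/

namespace Literature.NumberTheory.LFunctions.ThetaChainRun

open ThetaChain

set_option maxHeartbeats 0 in
/-- **Data-free certified `θ`-run, chunk 29a** (steps `4200001`–`4250000` after `8886113`: 50000 primes,
`82291571` to `83202829`). [cite: Schoenfeld1976, Thm. 10 (6.3)] -/
theorem frun29a :
    runFree 50000
      ⟨82291571, 22033615108756725740673297, 22033615108757201441967209, 99473468975227370004000033546976, 99473468975229650932285251664145⟩ =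
    some ⟨83202829, 22046928604057341402457000, 22046928604057817104701097, 100575482563325074811516268495597, 100575482563327379524889936863896⟩ := by
  decide +kernel

set_option maxHeartbeats 0 in
/-- **Data-free certified `θ`-run, chunk 29b** (steps `4250001`–`4300000` after `8886113`: 50000 primes,
`83202829` to `84114959`). [cite: Schoenfeld1976, Thm. 10 (6.3)] -/
theorem frun29b :
    runFree 50000
      ⟨83202829, 22046928604057341402457000, 22046928604057817104701097, 100575482563325074811516268495597, 100575482563327379524889936863896⟩ =
    some ⟨84114959, 22060109610629155234312347, 22060109610629630937506589, 101678159211737982205396725136584, 101678159211740310703906352740358⟩ := by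
  decide +kernel

set_option maxHeartbeats 0 in
/-- **Data-free certified `θ`-run, chunk 29c** (steps `4300001`–`4350000` after `8886113`: 50000 primes,
`84114959` to `85030553`). [cite: Schoenfeld1976, Thm. 10 (6.3)] -/
theorem frun29c :
    runFree 50000
      ⟨84114959, 22060109610629155234312347, 22060109610629630937506589, 101678159211737982205396725136584, 101678159211740310703906352740358⟩ =
    some ⟨85030553, 22073197702946779880475101, 22073197702947255584619478, 102781492055701870923345466381709, 102781492055704223207038559600263⟩ := by
  decide +kernel

end Literature.NumberTheory.LFunctions.ThetaChainRun
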